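import Summits.QuantumFields.YangMills.Theorems.UnitScaleTiltFluctuationComparisonRegPrGlobalSlackKernelLegResidual
import Summits.QuantumFields.YangMills.Theorems.UnitScaleTiltFluctuationComparisonRegPrGlobalSlackCanonicalEndToEndChi
import HarnessLib

/-!
# `UnitScaleTiltFluctuationComparisonRegPrGlobalSlackKernelLegChi` — STUB 3⁗χ OF v5kC FROM PRINT'S LEG CURRENCY (43)×(44) AT THE χ-RECORD'S CANONICAL POLYMERISATION, BY NAME
# (crux `FluctuationComparisonRegPrIntL`, stmt-QuantumFields-20520, skeleton v5kC (OWNER C3; R-57χ ADD. 6 token map), STUB 3⁗χ `stub_globalTwoRunSlackFamChi`; width-lever lane B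
# «(R1) print's χ of [Balaban1985UV3] (47) back», seat ym-ust-19935-r1 g4; core port, leg-currency annex)

Lane A's final 3⁗ currency (seat ym-ust-19935-slack g2: `…KernelLegWeights` p546063, `…LegEndToEnd` p546731, `…LegGeometry` p548146, `…LegSummableT` p548976, `…LegGeometrySum`
p549363, `…LegResidual` p549908) reduces the registered v5k text 3⁗ BY NAME to `K1aLegRowsR L 𝔠 a₀ a₁ a`: FIVE analytic leg rows over one chart family `(Φ, e, B)` at the canonical
leg distance `canonLegDist F` — K1a `FlatKernelLegCauchyΦ`, (43) `KernelLegPointwiseΦ`, `RemainderSmallΦ` for the residual rest, (44) `CfgDistΦ`, `CfgDistCauchyΦ` — the geometry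
(`DistNonneg`, `DistMatched`, `LegSummableT`) being THEOREMS.  Those definitions/reductions are stated over `p : ∀ K, PkgAtV3` and `dataOfV3 p (canonPolymer p)`; this file carries
them to the χ-record (`PkgAtV3Chi`, `dataOfV3chi p (canonPolymerCore (toCore ∘ p))`):

* §1 `card_anchors_canonCore_le`, **`legSummableT_canonCore`** — the anchor count / leg summability on the listed domains of the CORE canonical polymerisation (lane A's
  `card_anchors_canon_le`/`legSummableT_canon` with `p ↦ q : ∀ K, PkgCoreV3`; every p-free geometric lemma — `anchors`, `shadow`, `card_shadow_domSet_le`, `card_dom_le_treeLen`,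
  `sum_exp_canonLegDist_le`, `legSumConst` — IMPORTED);
* §2 `residualRemCore`, `taylorSplitΦ_residualCore` (the residual rest of `canonPTCore q`);
* §3 the χ-twins of lane A's leg-row schemas under the token map — **`K1aLegRowsTChi`** (pointwise form with growth summability, free leg distance), **`K1aLegRowsGChi`** (geometry
  discharged at `canonLegDist F`), **`K1aLegRowsRChi`** (five rows over `(Φ, e, B)`) — with the reductions `k1aChartRowsCChi_of_legRowsTChi` (rescaled pair `(Φ∘D_w, D_w⁻¹B)`,
  `κ := 𝔠.κ − ½`; lane A's `k1aChartRowsC_of_legRowsT` verbatim at the χ-datum), `k1aLegRowsTChi_of_GChi`, `k1aLegRowsGChi_of_RChi`, and the capstones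
  **`globalTwoRunSlackFamChi_of_k1aLegRowsGChi`** / **`globalTwoRunSlackFamChi_of_k1aLegRowsRChi`** : ⟨THE TEXT OF `stub_globalTwoRunSlackFamChi` VERBATIM⟩.
WHAT 3⁗χ NOW IS, BY NAME: `K1aLegRowsRChi` — per record a rate `a`, rates `κ′ < κ₁`, constants, `γB`; per family / coupling / inhabited χ-package a coherent `p : ∀ K, PkgAtV3Chi` and ONE
chart family with vacuum constants and loop variables carrying (43), (44), the seventh-order residual row, the 19200-side `CfgDistCauchyΦ`, and the core K1a `FlatKernelLegCauchyΦ`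
— exactly lane A's list for 3⁗, no geometry row, no letter on the record.  Hypothesis schemas only; nothing of [Balaban1985UV3]/[King1986] is asserted; no numerics; registry untouched.

References: T. Bałaban, CMP 102 (1985) 255–275 [Balaban1985UV3] ((24) p.262, (30) p.263, (43)–(47) pp.266–267, (57) p.270, (59) p.270); CMP 109 (1987) 249–301 [Balaban1987RG1]
((0.1) p.251, (0.26) p.257); C. King, CMP 102 (1986) 649–677 [King1986] (Thm 3.4 (3.9) p.656, Prop. 3.6 (3.56) p.662, Prop. 3.9 (3.71)–(3.74) p.665).
-/

set_option autoImplicit false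

noncomputable section

open scoped BigOperators
open Finset
open Literature.MathematicalPhysics.QuantumFieldTheory.Balaban1983to89
open Literature.MathematicalPhysics.QuantumFieldTheory.Balaban1983to89.T3ContinuumYM3Torus
open Literature.MathematicalPhysics.QuantumFieldTheory.Balaban1983to89.T3UnitScaleTilt
open Literature.MathematicalPhysics.QuantumFieldTheory.Balaban1983to89.T3LevelShift
open Literature.MathematicalPhysics.QuantumFieldTheory.Balaban1983to89.T3AlphaInputsAC
open Literature.MathematicalPhysics.QuantumFieldTheory.Balaban1983to89.T3AlphaPolymerSocket
open Literature.MathematicalPhysics.QuantumFieldTheory.Balaban1983to89.T3AlphaInputsACTwoRun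
open Literature.MathematicalPhysics.QuantumFieldTheory.Balaban1983to89.T3AlphaInputsACTwoRunLevel
open Literature.MathematicalPhysics.QuantumFieldTheory.Balaban1983to89.TreeLengthTorus (tsys TPt card_le_torusTreeLen)
open Literature.MathematicalPhysics.QuantumFieldTheory.Balaban1983to89.B12Decay510Window (K₁ K₁_nonneg)
open Literature.MathematicalPhysics.QuantumFieldTheory.Balaban1983to89.B12TreeDecay (kappa₀ kappa₀_nonneg)
open Literature.MathematicalPhysics.QuantumFieldTheory.Balaban1985CMP102
open Literature.MathematicalPhysics.QuantumFieldTheory.Balaban1985CMP102.Setting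
open Summit.QuantumFields.Balaban3D.Carriers
open Summit.QuantumFields.Balaban3D.Proofs.Primitives
open Summit.QuantumFields.Balaban3D.Proofs.GroupModelLieC (lieC)
open Summit.QuantumFields.Balaban3D.Proofs.Representation33 (jet26)
open Summit.QuantumFields.Balaban3D.Proofs.TorusLift (val_coarsen)
open Summit.QuantumFields.YangMills.Theorems
open Summit.QuantumFields.YangMills.Theorems.GlobalSlackKernelMatching
open Summit.QuantumFields.YangMills.Theorems.GlobalSlackCanonicalPolymers

namespace Summit.QuantumFields.YangMills.Theorems.GlobalSlackKernelLeg

variable {F : T3Family} {𝔠 : AlphaConsts F.L (suGroupModel 2).N} {γ : ℝ} {hγ : 0 < γ} {hγ1 : γ ≤ (min 𝔠.gamma0 1) ^ 2}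

/-! ## §1 Anchor count and leg summability on the listed domains of the core canonical polymerisation -/

/-- **THE ANCHOR COUNT ON THE LISTED DOMAINS OF A FAMILY OF DATA CORES**: for every `Y ∈ Loc K j h i` of the core canonical polymerisation `canonPolymerCore q` (term level `i = 1+b`),
`#anchors K b Y ≤ max(L³, 32M₁³)·(1 + 𝓛(Y))`. [cite: Balaban1985UV3, (24) p.262, (45) p.267, (59) p.270] -/
theorem card_anchors_canonCore_le (q : ∀ K, AlphaInputsT3AC.PkgCoreV3 F 𝔠 γ hγ hγ1 K) (K j : ℕ) (h : Hist (F.P K) j) (b : ℕ) (Y : Set (Site (F.P K) 0))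
    (hY : Y ∈ canonLocCore q K j h (1 + b)) :
    ((anchors K b Y).card : ℝ) ≤ max ((F.L : ℝ) ^ 3) (32 * (𝔠.M₁ : ℝ) ^ 3) * (1 + canonTreeLenCore q K (1 + b) Y) := by
  classical
  have hT0 : 0 ≤ canonTreeLenCore q K (1 + b) Y := canonTreeLenCore_nonneg q K (1 + b) Y
  have hmax1 : (1 : ℝ) ≤ max ((F.L : ℝ) ^ 3) (32 * (𝔠.M₁ : ℝ) ^ 3) := by
    have hL1 : (1 : ℝ) ≤ F.L := by exact_mod_cast F.hL.2.le
    exact le_max_of_le_left (one_le_pow₀ hL1)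
  have hmax0 : (0 : ℝ) ≤ max ((F.L : ℝ) ^ 3) (32 * (𝔠.M₁ : ℝ) ^ 3) := zero_le_one.trans hmax1
  by_cases hspec : Y = Set.univ ∨ shadow K b Y = ∅ ∨ F.m + K < b
  · -- single anchor (the origin)
    have hA : anchors K b Y = {default} := by unfold anchors; rw [if_pos hspec]
    rw [hA, Finset.card_singleton, Nat.cast_one]
    nlinarith
  · -- the shadow of a listed block or domain
    have hA : anchors K b Y = shadow K b Y := by unfold anchors; rw [if_neg hspec]
    have hYne : Y ≠ Set.univ := fun hu => hspec (Or.inl hu)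
    rw [hA]
    cases j with
    | zero => simp [canonLocCore] at hY
    | succ k =>
      by_cases hk : k + 1 ≤ K
      · by_cases hik : 1 + b = k + 1
        · -- NEW-term domain at step `b = k`
          have hbk : k = b := by omega
          subst hbk
          simp only [canonLocCore, if_pos hk, if_pos hik, mem_image] at hY
          obtain ⟨X, -, rfl⟩ := hY
          have hbm : k ≤ F.m + K := by have := F.hm; omega
          have h1 := card_shadow_domSet_le (γ := γ) (hγ := hγ) (hγ1 := hγ1) K k X
          have h2 := card_dom_le_treeLen X
          have hdj0 := (tsys 3 (nblkOf (SK F 𝔠 γ hγ hγ1 K) 𝔠.lane.carrier k)).dj_nonneg X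
          rw [show 1 + k = k + 1 by ring, canonTreeLenCore_domSet q K k hbm X]
          have hM3 : (0 : ℝ) ≤ (𝔠.M₁ : ℝ) ^ 3 := by positivity
          calc ((shadow K k (domSet (F := F) 𝔠.lane.carrier.M₁ K k X)).card : ℝ) ≤ (𝔠.M₁ : ℝ) ^ 3 * X.1.card := h1
            _ ≤ (𝔠.M₁ : ℝ) ^ 3 * (32 * (1 + (tsys 3 _).dj X)) := mul_le_mul_of_nonneg_left h2 hM3
            _ = (32 * (𝔠.M₁ : ℝ) ^ 3) * (1 + (tsys 3 _).dj X) := by ring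
            _ ≤ max ((F.L : ℝ) ^ 3) (32 * (𝔠.M₁ : ℝ) ^ 3) * (1 + (tsys 3 _).dj X) := mul_le_mul_of_nonneg_right (le_max_right _ _) (by linarith)
        · by_cases hi : 1 + b ∈ Finset.Icc 1 k
          · -- OLD-term block at level `1 + b`
            simp only [canonLocCore, if_pos hk, if_neg hik, if_pos hi, mem_image] at hY
            obtain ⟨y, -, rfl⟩ := hY
            have hbm : 1 + b ≤ F.m + K := by have := (Finset.mem_Icc.mp hi).2; have := F.hm; omega
            have h1 := card_shadow_blockSet_le K b (1 + b) (by ring) hbm y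
            calc ((shadow K b (blockSet K (1 + b) y)).card : ℝ) ≤ ((F.L ^ 3 : ℕ) : ℝ) := by exact_mod_cast h1
              _ = (F.L : ℝ) ^ 3 := by push_cast; ring
              _ ≤ max ((F.L : ℝ) ^ 3) (32 * (𝔠.M₁ : ℝ) ^ 3) * 1 := by rw [mul_one]; exact le_max_left _ _
              _ ≤ max ((F.L : ℝ) ^ 3) (32 * (𝔠.M₁ : ℝ) ^ 3) * (1 + canonTreeLenCore q K (1 + b) (blockSet K (1 + b) y)) :=
                  mul_le_mul_of_nonneg_left (by linarith [canonTreeLenCore_nonneg q K (1 + b) (blockSet K (1 + b) y)]) hmax0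
          · simp only [canonLocCore, if_pos hk, if_neg hik, if_neg hi] at hY
            simp at hY
      · by_cases hi1 : 1 + b = 1
        · -- the dummy whole-torus domain has the origin as anchor set: excluded by `hYne`
          simp only [canonLocCore, if_neg hk, if_pos hi1, mem_singleton] at hY
          exact absurd hY hYne
        · simp only [canonLocCore, if_neg hk, if_neg hi1] at hY
          simp at hY

/-- **`LegSummableT` FOR THE CANONICAL LEG DISTANCE ON THE CANONICAL POLYMERISATION OF A FAMILY OF DATA CORES — DISCHARGED**: for every `a > 0` and every `q : ∀ K, PkgCoreV3 …`,
`Σ_c e^{−a·d(c)} ≤ legSumConst·(1 + 𝓛(Y))` on every listed domain. [cite: Balaban1985UV3, (45) p.267] -/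
theorem legSummableT_canonCore (q : ∀ K, AlphaInputsT3AC.PkgCoreV3 F 𝔠 γ hγ hγ1 K) {a : ℝ} (ha : 0 < a) :
    LegSummableT (AlphaInputsT3AC.dataOfCoreV3 q (canonPolymerCore q)) (canonLegDist F) a (legSumConst F.L 𝔠 a) := by
  intro K k b Y hY
  have hK : 0 ≤ 3 * K₁ 3 a := by have := K₁_nonneg 3 a; positivity
  refine (sum_exp_canonLegDist_le K b Y ha).trans ?_
  have hc := card_anchors_canonCore_le q K k (Hist.triv (F.P K) k) b Y hY
  calc 3 * K₁ 3 a * ((anchors K b Y).card : ℝ) ≤ 3 * K₁ 3 a * (max ((F.L : ℝ) ^ 3) (32 * (𝔠.M₁ : ℝ) ^ 3) * (1 + canonTreeLenCore q K (1 + b) Y)) :=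
        mul_le_mul_of_nonneg_left hc hK
    _ = legSumConst F.L 𝔠 a * (1 + canonTreeLenCore q K (1 + b) Y) := by unfold legSumConst; ring


/-! ## §2 The residual rest of the core term function -/

section Residual

variable {𝕍 : Type} [NormedAddCommGroup 𝕍] [NormedSpace ℂ 𝕍]

/-- **THE RESIDUAL REST** of the core canonical term function against a chart family, vacuum constants and loop variables: `R := canonPTCore q − e − Re jet26(Φ)(B)`
(lane A's `residualRem` over `PkgCoreV3`). [cite: Balaban1985UV3, (30) p.263, (43) p.266, (57) p.270] -/
def residualRemCore (q : ∀ K, AlphaInputsT3AC.PkgCoreV3 F 𝔠 γ hγ hγ1 K) (Φ : ChartFam 𝕍 F) (e : VacFam F) (B : CfgFam 𝕍 F) : RemFam F :=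
  fun K k b Y W => canonPTCore q K k (1 + b) Y W - e K b Y - (jet26 (Φ K b Y) (B K k b Y W)).re

/-- **`TaylorSplitΦ` HOLDS BY DEFINITION for the core residual rest.** [cite: Balaban1985UV3, (30) p.263, (43) p.266] -/
theorem taylorSplitΦ_residualCore (q : ∀ K, AlphaInputsT3AC.PkgCoreV3 F 𝔠 γ hγ hγ1 K) (Φ : ChartFam 𝕍 F) (e : VacFam F) (B : CfgFam 𝕍 F) :
    TaylorSplitΦ (canonPTCore q) Φ e B (residualRemCore q Φ e B) := by
  intro K k b Y W
  unfold residualRemCore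
  ring

/-- `residualRem p = residualRemCore (toCore ∘ p)` (definitional, `canonPT_eq_core`). [folklore] -/
theorem residualRem_eq_core (p : ∀ K, AlphaInputsT3AC.PkgAtV3 F 𝔠 γ hγ hγ1 K) (Φ : ChartFam 𝕍 F) (e : VacFam F) (B : CfgFam 𝕍 F) :
    residualRem p Φ e B = residualRemCore (fun K => (p K).toCore) Φ e B := by
  funext K k b Y W
  simp only [residualRem, residualRemCore, canonPT_eq_core]

end Residual

/-! ## §3 The leg-row schemas at the χ-record and the registered stub 3⁗χ -/

/-- **THE K1a LEG ROWS AT THE χ-RECORD, POINTWISE FORM WITH GROWTH SUMMABILITY** (hypothesis schema, never asserted) — lane A's `K1aLegRowsT` under the R-57χ token map: rates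
`0 < κ′ < κ₁`, a summability constant `S ≥ 1`, nonnegative constants, a threshold, and for every family / coupling / inhabited χ-package a coherent `p : ∀ K, PkgAtV3Chi …` with the given
[7]-constants, a leg distance and ONE chart family with the geometry rows `DistNonneg`, `DistMatched`, `LegSummableT` and the six analytic leg rows `TaylorSplitΦ (canonPTCore (toCore ∘ p))`,
K1a `FlatKernelLegCauchyΦ`, (43) `KernelLegPointwiseΦ`, `RemainderSmallΦ`, (44) `CfgDistΦ`, `CfgDistCauchyΦ` at `dataOfV3chi p (canonPolymerCore (toCore ∘ p))`, decay `𝔠.κ`, profile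
`p₀`. [cite: Balaban1985UV3, (43)-(47) pp.266-267; King1986, Prop. 3.6 (3.56) p.662] -/
def K1aLegRowsTChi (L : ℕ) (𝔠 : AlphaConsts L (suGroupModel 2).N) (a₀ a₁ a : ℝ) : Prop :=
  ∃ (κ' κ₁ S C A C_R C_s C_B γB : ℝ), 0 < κ' ∧ κ' < κ₁ ∧ 1 ≤ S ∧ 0 ≤ C ∧ 0 ≤ A ∧ 0 ≤ C_R ∧ 0 ≤ C_s ∧ 0 ≤ C_B ∧ 0 < γB ∧
    ∀ (F : T3Family) (γ : ℝ) (hF : F.L = L) (hγ : 0 < γ), γ ≤ γB → ∀ (hγ1 : γ ≤ (min (hF ▸ 𝔠).gamma0 1) ^ 2),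
      AlphaInputsT3AC.OfV3ChiAt F (hF ▸ 𝔠) a₀ a₁ →
        ∃ (p : ∀ K, AlphaInputsT3AC.PkgAtV3Chi F (hF ▸ 𝔠) γ hγ hγ1 K), (∀ K, (p K).a₀ = a₀ ∧ (p K).a₁ = a₁) ∧
          ∃ (dist : LegDist F) (Φ : ChartFam ↥(lieC (suGroupModel 2)) F) (e : VacFam F) (B : CfgFam ↥(lieC (suGroupModel 2)) F) (R : RemFam F),
            DistNonneg dist ∧ DistMatched dist ∧
            LegSummableT (AlphaInputsT3AC.dataOfV3chi p (canonPolymerCore fun K => (p K).toCore)) dist (κ₁ - κ') S ∧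
            TaylorSplitΦ (canonPTCore fun K => (p K).toCore) Φ e B R ∧
            FlatKernelLegCauchyΦ (AlphaInputsT3AC.dataOfV3chi p (canonPolymerCore fun K => (p K).toCore)) Φ dist κ' (hF ▸ 𝔠).κ a C ∧
            KernelLegPointwiseΦ (AlphaInputsT3AC.dataOfV3chi p (canonPolymerCore fun K => (p K).toCore)) Φ dist κ₁ (hF ▸ 𝔠).κ A ∧
            RemainderSmallΦ (AlphaInputsT3AC.dataOfV3chi p (canonPolymerCore fun K => (p K).toCore)) R (hF ▸ 𝔠).b₀ (hF ▸ 𝔠).p₀ (hF ▸ 𝔠).κ C_R ∧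
            CfgDistΦ (AlphaInputsT3AC.dataOfV3chi p (canonPolymerCore fun K => (p K).toCore)) B dist (hF ▸ 𝔠).b₀ (hF ▸ 𝔠).p₀ C_s ∧
            CfgDistCauchyΦ (AlphaInputsT3AC.dataOfV3chi p (canonPolymerCore fun K => (p K).toCore)) B dist (hF ▸ 𝔠).b₀ (hF ▸ 𝔠).p₀ a C_B

/-- **THE TREE-WEIGHTED LEG ROWS AT THE χ-RECORD GIVE THE χ-CHART ROWS at `κ := 𝔠.κ − ½`** (`AlphaConsts.kappa_ge`; the half unit of tree decay pays the domain growth, `ε = ½`),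
through the rescaled pair `(Φ∘D_w, D_w⁻¹B)` — lane A's `k1aChartRowsC_of_legRowsT` at the χ-datum. [cite: Balaban1985UV3, (43)-(45) pp.266-267; Balaban1987RG1, (0.26) p.257] -/
theorem k1aChartRowsCChi_of_legRowsTChi {L : ℕ} {𝔠 : AlphaConsts L (suGroupModel 2).N} {a₀ a₁ a : ℝ} (h : K1aLegRowsTChi L 𝔠 a₀ a₁ a) :
    K1aChartRowsCChi L 𝔠 a₀ a₁ a := by
  obtain ⟨κ', κ₁, S, C, A, C_R, C_s, C_B, γB, hκ', hκ1, hS, hC, hA, hCR, hCs, hCB, hγB, hall⟩ := h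
  have hk1 : 0 ≤ 1 + κ'⁻¹ := by positivity
  -- the record's decay budget: `κ₀(32,6) + 1 ≤ 𝔠.κ`
  have hκhalf : kappa₀ (4 * 2 ^ 3) (2 * 3) ≤ 𝔠.κ - 1 / 2 ∧ 0 < 𝔠.κ - 1 / 2 := by
    have hge := 𝔠.kappa_ge
    have h0 : 0 ≤ kappa₀ (4 * 2 ^ 3) (2 * 3) := kappa₀_nonneg (by norm_num) _
    set k := kappa₀ (4 * 2 ^ 3) (2 * 3) with hk
    constructor <;> linarith
  set C_E : ℝ := A * S ^ 6 * (6 / (1 / 2 : ℝ)) ^ 6 with hCE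
  have hCE0 : 0 ≤ C_E := by rw [hCE]; have := zero_le_one.trans hS; positivity
  refine ⟨𝔠.κ - 1 / 2, C, C_E, C_R, C_s * (1 + κ'⁻¹), C_B * (1 + κ'⁻¹), γB, hκhalf.2, by linarith, hκhalf.1, hC, hCE0, hCR,
    mul_nonneg hCs hk1, mul_nonneg hCB hk1, hγB, fun F γ hF hγ hγle hγ1 hOf => ?_⟩
  subst hF
  obtain ⟨p, hp, dist, Φ, e, B, R, hn, hm, hsum, hT, hK, hP, hR, hSz, hBC⟩ := hall F γ rfl hγ hγle hγ1 hOf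
  have hL : 1 ≤ F.L := F.hL.2.le
  have hγ1' : γ ≤ 1 := hγ1.trans (sq_min_one_le _ 𝔠.gamma0_pos)
  have hTl : ∀ K i Y, 0 ≤ (AlphaInputsT3AC.dataOfV3chi p (canonPolymerCore fun K => (p K).toCore)).treeLen K i Y :=
    fun K i Y => canonTreeLenCore_nonneg (fun K => (p K).toCore) K i Y
  have hθ : ∀ n, 0 ≤ θBal F.L γ 𝔠.b₀ 𝔠.p₀ n := fun n => (T3MinimiserStabilityReduction.θBal_pos hL hγ hγ1' 𝔠.b₀_pos 𝔠.p₀ n).le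
  have hE : KernelLegΦ (AlphaInputsT3AC.dataOfV3chi p (canonPolymerCore fun K => (p K).toCore)) Φ dist κ' (𝔠.κ - 1 / 2) C_E :=
    kernelLegΦ_of_pointwise_T hn hTl (by linarith) hA hS (by norm_num) (by norm_num) hP hsum
  have hK' := flatKernelLegCauchyΦ_mono hTl (show 𝔠.κ - 1 / 2 ≤ 𝔠.κ by linarith) hC hK
  have hR' := remainderSmallΦ_mono hTl hθ (show 𝔠.κ - 1 / 2 ≤ 𝔠.κ by linarith) hCR hR
  exact ⟨p, hp, rescaleΦw dist κ' Φ, e, rescaleBw dist κ' B, R, taylorSplitΦ_rescaleW dist κ' hT, flatKernelCauchyΦ_rescaleW hm hK',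
    kernelSizeΦ_rescaleW hE, hR', cfgSizeΦ_rescaleW hL hγ hγ1' 𝔠.b₀_pos hn hm hκ' hCs hSz, cfgCauchyΦ_rescaleW hL hγ hγ1' 𝔠.b₀_pos hn hm hκ' hCB hBC⟩

/-- **THE K1a LEG ROWS AT THE χ-RECORD AT THE CANONICAL LEG DISTANCE — GEOMETRY DISCHARGED** (hypothesis schema, never asserted) — lane A's `K1aLegRowsG` under the token map:
rates `0 < κ′ < κ₁`, nonnegative constants, a threshold, and for every family / coupling / inhabited χ-package a coherent `p : ∀ K, PkgAtV3Chi …` and ONE chart family with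
configurations / vacuum constants / rests carrying EXACTLY the six analytic rows at `canonLegDist F`: `TaylorSplitΦ (canonPTCore (toCore ∘ p))`, K1a `FlatKernelLegCauchyΦ` (weights
`κ′`), (43) `KernelLegPointwiseΦ` (per-leg decay `κ₁`, `g`-free), `RemainderSmallΦ`, (44) `CfgDistΦ`, `CfgDistCauchyΦ` — decay `𝔠.κ`, profile `p₀`; NO geometry row, NO letter on the
record. [cite: Balaban1985UV3, (43)-(47) pp.266-267, (57) p.270; King1986, Prop. 3.6 (3.56) p.662, Prop. 3.9 (3.71)-(3.74) p.665] -/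
def K1aLegRowsGChi (L : ℕ) (𝔠 : AlphaConsts L (suGroupModel 2).N) (a₀ a₁ a : ℝ) : Prop :=
  ∃ (κ' κ₁ C A C_R C_s C_B γB : ℝ), 0 < κ' ∧ κ' < κ₁ ∧ 0 ≤ C ∧ 0 ≤ A ∧ 0 ≤ C_R ∧ 0 ≤ C_s ∧ 0 ≤ C_B ∧ 0 < γB ∧
    ∀ (F : T3Family) (γ : ℝ) (hF : F.L = L) (hγ : 0 < γ), γ ≤ γB → ∀ (hγ1 : γ ≤ (min (hF ▸ 𝔠).gamma0 1) ^ 2),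
      AlphaInputsT3AC.OfV3ChiAt F (hF ▸ 𝔠) a₀ a₁ →
        ∃ (p : ∀ K, AlphaInputsT3AC.PkgAtV3Chi F (hF ▸ 𝔠) γ hγ hγ1 K), (∀ K, (p K).a₀ = a₀ ∧ (p K).a₁ = a₁) ∧
          ∃ (Φ : ChartFam ↥(lieC (suGroupModel 2)) F) (e : VacFam F) (B : CfgFam ↥(lieC (suGroupModel 2)) F) (R : RemFam F),
            TaylorSplitΦ (canonPTCore fun K => (p K).toCore) Φ e B R ∧
            FlatKernelLegCauchyΦ (AlphaInputsT3AC.dataOfV3chi p (canonPolymerCore fun K => (p K).toCore)) Φ (canonLegDist F) κ' (hF ▸ 𝔠).κ a C ∧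
            KernelLegPointwiseΦ (AlphaInputsT3AC.dataOfV3chi p (canonPolymerCore fun K => (p K).toCore)) Φ (canonLegDist F) κ₁ (hF ▸ 𝔠).κ A ∧
            RemainderSmallΦ (AlphaInputsT3AC.dataOfV3chi p (canonPolymerCore fun K => (p K).toCore)) R (hF ▸ 𝔠).b₀ (hF ▸ 𝔠).p₀ (hF ▸ 𝔠).κ C_R ∧
            CfgDistΦ (AlphaInputsT3AC.dataOfV3chi p (canonPolymerCore fun K => (p K).toCore)) B (canonLegDist F) (hF ▸ 𝔠).b₀ (hF ▸ 𝔠).p₀ C_s ∧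
            CfgDistCauchyΦ (AlphaInputsT3AC.dataOfV3chi p (canonPolymerCore fun K => (p K).toCore)) B (canonLegDist F) (hF ▸ 𝔠).b₀ (hF ▸ 𝔠).p₀ a C_B

/-- **THE GEOMETRY IS DISCHARGED AT THE χ-RECORD**: `K1aLegRowsGChi → K1aLegRowsTChi` with `dist := canonLegDist F`, `S := max 1 (legSumConst L 𝔠 (κ₁ − κ′))` (`canonLegDist_nonneg`,
`canonLegDist_matched`, `legSummableT_canonCore`). [cite: Balaban1985UV3, (45) p.267; Balaban1987RG1, (0.1) p.251] -/
theorem k1aLegRowsTChi_of_GChi {L : ℕ} {𝔠 : AlphaConsts L (suGroupModel 2).N} {a₀ a₁ a : ℝ} (h : K1aLegRowsGChi L 𝔠 a₀ a₁ a) : K1aLegRowsTChi L 𝔠 a₀ a₁ a := by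
  obtain ⟨κ', κ₁, C, A, C_R, C_s, C_B, γB, hκ', hκ1, hC, hA, hCR, hCs, hCB, hγB, hall⟩ := h
  refine ⟨κ', κ₁, max 1 (legSumConst L 𝔠 (κ₁ - κ')), C, A, C_R, C_s, C_B, γB, hκ', hκ1, le_max_left _ _, hC, hA, hCR, hCs, hCB, hγB,
    fun F γ hF hγ hγle hγ1 hOf => ?_⟩
  subst hF
  obtain ⟨p, hp, Φ, e, B, R, hT, hK, hP, hR, hS, hBC⟩ := hall F γ rfl hγ hγle hγ1 hOf
  have hTl : ∀ K i Y, 0 ≤ (AlphaInputsT3AC.dataOfV3chi p (canonPolymerCore fun K => (p K).toCore)).treeLen K i Y :=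
    fun K i Y => canonTreeLenCore_nonneg (fun K => (p K).toCore) K i Y
  exact ⟨p, hp, canonLegDist F, Φ, e, B, R, canonLegDist_nonneg F, canonLegDist_matched F,
    legSummableT_mono_S hTl (le_max_right _ _) (legSummableT_canonCore (fun K => (p K).toCore) (by linarith)), hT, hK, hP, hR, hS, hBC⟩

/-- **THE K1a LEG ROWS AT THE χ-RECORD OVER `(Φ, e, B)` ONLY** (hypothesis schema, never asserted) — lane A's `K1aLegRowsR` under the token map: `K1aLegRowsGChi` with the rest
ELIMINATED — the remainder row is stated for the RESIDUAL `canonPTCore (toCore ∘ p) − e − Re jet26(Φ)(B)` (= (M1) TO SEVENTH ORDER + the far terms (57)/G3D-06); plus K1a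
`FlatKernelLegCauchyΦ`, (43) `KernelLegPointwiseΦ`, (44) `CfgDistΦ`, `CfgDistCauchyΦ` at the canonical leg distance. [cite: Balaban1985UV3, (43)-(44) pp.266-267, (47) p.267, (57) p.270; King1986, Prop. 3.6 (3.56) p.662, Prop. 3.9 (3.71)-(3.74) p.665] -/
def K1aLegRowsRChi (L : ℕ) (𝔠 : AlphaConsts L (suGroupModel 2).N) (a₀ a₁ a : ℝ) : Prop :=
  ∃ (κ' κ₁ C A C_R C_s C_B γB : ℝ), 0 < κ' ∧ κ' < κ₁ ∧ 0 ≤ C ∧ 0 ≤ A ∧ 0 ≤ C_R ∧ 0 ≤ C_s ∧ 0 ≤ C_B ∧ 0 < γB ∧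
    ∀ (F : T3Family) (γ : ℝ) (hF : F.L = L) (hγ : 0 < γ), γ ≤ γB → ∀ (hγ1 : γ ≤ (min (hF ▸ 𝔠).gamma0 1) ^ 2),
      AlphaInputsT3AC.OfV3ChiAt F (hF ▸ 𝔠) a₀ a₁ →
        ∃ (p : ∀ K, AlphaInputsT3AC.PkgAtV3Chi F (hF ▸ 𝔠) γ hγ hγ1 K), (∀ K, (p K).a₀ = a₀ ∧ (p K).a₁ = a₁) ∧
          ∃ (Φ : ChartFam ↥(lieC (suGroupModel 2)) F) (e : VacFam F) (B : CfgFam ↥(lieC (suGroupModel 2)) F),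
            FlatKernelLegCauchyΦ (AlphaInputsT3AC.dataOfV3chi p (canonPolymerCore fun K => (p K).toCore)) Φ (canonLegDist F) κ' (hF ▸ 𝔠).κ a C ∧
            KernelLegPointwiseΦ (AlphaInputsT3AC.dataOfV3chi p (canonPolymerCore fun K => (p K).toCore)) Φ (canonLegDist F) κ₁ (hF ▸ 𝔠).κ A ∧
            RemainderSmallΦ (AlphaInputsT3AC.dataOfV3chi p (canonPolymerCore fun K => (p K).toCore)) (residualRemCore (fun K => (p K).toCore) Φ e B)
              (hF ▸ 𝔠).b₀ (hF ▸ 𝔠).p₀ (hF ▸ 𝔠).κ C_R ∧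
            CfgDistΦ (AlphaInputsT3AC.dataOfV3chi p (canonPolymerCore fun K => (p K).toCore)) B (canonLegDist F) (hF ▸ 𝔠).b₀ (hF ▸ 𝔠).p₀ C_s ∧
            CfgDistCauchyΦ (AlphaInputsT3AC.dataOfV3chi p (canonPolymerCore fun K => (p K).toCore)) B (canonLegDist F) (hF ▸ 𝔠).b₀ (hF ▸ 𝔠).p₀ a C_B

/-- The five rows give the six (`R := residualRemCore (toCore ∘ p)`, `TaylorSplitΦ` by definition). [cite: Balaban1985UV3, (43) p.266] -/
theorem k1aLegRowsGChi_of_RChi {L : ℕ} {𝔠 : AlphaConsts L (suGroupModel 2).N} {a₀ a₁ a : ℝ} (h : K1aLegRowsRChi L 𝔠 a₀ a₁ a) : K1aLegRowsGChi L 𝔠 a₀ a₁ a := by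
  obtain ⟨κ', κ₁, C, A, C_R, C_s, C_B, γB, hκ', hκ1, hC, hA, hCR, hCs, hCB, hγB, hall⟩ := h
  refine ⟨κ', κ₁, C, A, C_R, C_s, C_B, γB, hκ', hκ1, hC, hA, hCR, hCs, hCB, hγB, fun F γ hF hγ hγle hγ1 hOf => ?_⟩
  obtain ⟨p, hp, Φ, e, B, hK, hP, hR, hS, hBC⟩ := hall F γ hF hγ hγle hγ1 hOf
  exact ⟨p, hp, Φ, e, B, residualRemCore (fun K => (p K).toCore) Φ e B, taylorSplitΦ_residualCore (fun K => (p K).toCore) Φ e B, hK, hP, hR, hS, hBC⟩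

/-- **THE REGISTERED STUB 3⁗χ FROM THE SIX ANALYTIC LEG ROWS AT THE χ-RECORD, BY NAME** (`globalTwoRunSlackFamChi_of_k1aChartRowsCChi ∘ k1aChartRowsCChi_of_legRowsTChi ∘
k1aLegRowsTChi_of_GChi`): if for every odd `L ≥ 7`, every constants record and [7]-constants there is a rate exponent `0 < a < 1` with `K1aLegRowsGChi L 𝔠 a₀ a₁ a`, then the text of
`stub_globalTwoRunSlackFamChi` (skeleton v5kC of stmt-QuantumFields-20520, OWNER C3 pen) holds VERBATIM. [cite: King1986, Thm 3.4 (3.9) p.656, Prop. 3.6 p.662; Balaban1985UV3, (43)-(47) pp.266-267, (57) p.270] -/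
theorem globalTwoRunSlackFamChi_of_k1aLegRowsGChi
    (h : ∀ (L : ℕ), Odd L → 7 ≤ L → ∀ (𝔠 : AlphaConsts L (suGroupModel 2).N) (a₀ a₁ : ℝ), 0 < a₀ → 0 < a₁ → 𝔠.B₃ * a₁ ≤ a₀ →
      ∃ a : ℝ, 0 < a ∧ a < 1 ∧ K1aLegRowsGChi L 𝔠 a₀ a₁ a) :
    ∀ (L : ℕ), Odd L → 7 ≤ L → ∀ (𝔠 : Summit.QuantumFields.Balaban3D.Proofs.Primitives.AlphaConsts L (Summit.QuantumFields.Balaban3D.Carriers.suGroupModel 2).N)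
      (a₀ a₁ : ℝ), 0 < a₀ → 0 < a₁ → 𝔠.B₃ * a₁ ≤ a₀ →
      ∃ a : ℝ, 0 < a ∧ ∃ γB : ℝ, 0 < γB ∧ ∀ (F : T3Family) (γ : ℝ) (hF : F.L = L) (hγ : 0 < γ), γ ≤ γB →
        ∀ (hγ1 : γ ≤ (min (hF ▸ 𝔠).gamma0 1) ^ 2),
          Summit.QuantumFields.YangMills.Theorems.AlphaInputsT3AC.OfV3ChiAt F (hF ▸ 𝔠) a₀ a₁ →
          ∃ (p : ∀ K, Summit.QuantumFields.YangMills.Theorems.AlphaInputsT3AC.PkgAtV3Chi F (hF ▸ 𝔠) γ hγ hγ1 K),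
            (∀ K, (p K).a₀ = a₀ ∧ (p K).a₁ = a₁) ∧
            ∃ (π : Summit.QuantumFields.YangMills.Theorems.AlphaInputsT3AC.PolymerT3 F) (σ : ℕ) (C : ℝ), 7 ≤ σ ∧ 0 ≤ C ∧
              Summit.QuantumFields.YangMills.Theorems.GlobalSlack.GlobalSupRateTSlack (Summit.QuantumFields.YangMills.Theorems.AlphaInputsT3AC.dataOfV3chi p π) (hF ▸ 𝔠).b₀ (hF ▸ 𝔠).p₀ a σ C :=
  globalTwoRunSlackFamChi_of_k1aChartRowsCChi fun L hLo h7 𝔠 a₀ a₁ ha0 ha1 hw => by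
    obtain ⟨a, ha, ha1', hc⟩ := h L hLo h7 𝔠 a₀ a₁ ha0 ha1 hw
    exact ⟨a, ha, ha1', k1aChartRowsCChi_of_legRowsTChi (k1aLegRowsTChi_of_GChi hc)⟩

/-- **THE REGISTERED STUB 3⁗χ FROM FIVE LEG ROWS OVER `(Φ, e, B)` AT THE χ-RECORD, BY NAME** (`globalTwoRunSlackFamChi_of_k1aLegRowsGChi ∘ k1aLegRowsGChi_of_RChi`).
[cite: King1986, Thm 3.4 (3.9) p.656, Prop. 3.6 p.662; Balaban1985UV3, (43)-(47) pp.266-267, (57) p.270] -/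
theorem globalTwoRunSlackFamChi_of_k1aLegRowsRChi
    (h : ∀ (L : ℕ), Odd L → 7 ≤ L → ∀ (𝔠 : AlphaConsts L (suGroupModel 2).N) (a₀ a₁ : ℝ), 0 < a₀ → 0 < a₁ → 𝔠.B₃ * a₁ ≤ a₀ →
      ∃ a : ℝ, 0 < a ∧ a < 1 ∧ K1aLegRowsRChi L 𝔠 a₀ a₁ a) :
    ∀ (L : ℕ), Odd L → 7 ≤ L → ∀ (𝔠 : Summit.QuantumFields.Balaban3D.Proofs.Primitives.AlphaConsts L (Summit.QuantumFields.Balaban3D.Carriers.suGroupModel 2).N)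
      (a₀ a₁ : ℝ), 0 < a₀ → 0 < a₁ → 𝔠.B₃ * a₁ ≤ a₀ →
      ∃ a : ℝ, 0 < a ∧ ∃ γB : ℝ, 0 < γB ∧ ∀ (F : T3Family) (γ : ℝ) (hF : F.L = L) (hγ : 0 < γ), γ ≤ γB →
        ∀ (hγ1 : γ ≤ (min (hF ▸ 𝔠).gamma0 1) ^ 2),
          Summit.QuantumFields.YangMills.Theorems.AlphaInputsT3AC.OfV3ChiAt F (hF ▸ 𝔠) a₀ a₁ →
          ∃ (p : ∀ K, Summit.QuantumFields.YangMills.Theorems.AlphaInputsT3AC.PkgAtV3Chi F (hF ▸ 𝔠) γ hγ hγ1 K),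
            (∀ K, (p K).a₀ = a₀ ∧ (p K).a₁ = a₁) ∧
            ∃ (π : Summit.QuantumFields.YangMills.Theorems.AlphaInputsT3AC.PolymerT3 F) (σ : ℕ) (C : ℝ), 7 ≤ σ ∧ 0 ≤ C ∧
              Summit.QuantumFields.YangMills.Theorems.GlobalSlack.GlobalSupRateTSlack (Summit.QuantumFields.YangMills.Theorems.AlphaInputsT3AC.dataOfV3chi p π) (hF ▸ 𝔠).b₀ (hF ▸ 𝔠).p₀ a σ C :=
  globalTwoRunSlackFamChi_of_k1aLegRowsGChi fun L hLo h7 𝔠 a₀ a₁ ha0 ha1 hw => by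
    obtain ⟨a, ha, ha1', hc⟩ := h L hLo h7 𝔠 a₀ a₁ ha0 ha1 hw
    exact ⟨a, ha, ha1', k1aLegRowsGChi_of_RChi hc⟩

end Summit.QuantumFields.YangMills.Theorems.GlobalSlackKernelLeg

end
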